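import Summits.QuantumFields.BalabanUV.T4Continuum.Spine.NE4.KingCurrency

/-!
# Spine/NE4/KingCurrencyWindowWitness — node U2 in King's currency NEEDS A WINDOW: a scale-free Markov family with the tent
# β-function, two pinned runs one cutoff apart that differ at depth 1 for EVERY cutoff, although the shift modulus is ZERO,
# the memory fades at every rate, and both asymptotic-freedom binders hold

Cell `pub-balaban-gaps` (YM blitz G2), seat `ne4` generation 14 (unit `pub-balaban-gaps-ne4-g14`), record `HOME/ne/NE4.md` §5 census
item (R52)(ii); companion of `Spine/NE4/KingCurrencyGap` ((R52)(i): node U2 in King's currency closes WITHOUT the asymptotic-freedom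
binder under the window `C·(γ³∕2)·τ∕(τ−θ) ≤ (1−τ)∕2`, e.g. `4·C·γ³ ≤ (1−θ)²`) and of `Spine/NE4/KingCurrencyWindow` (p384458, (R51):
the same END under `EventualLowerH b γ k₀` and `C((k₀+1)γ³ + 2γ∕b) ≤ (1−θ)∕2`).  Both ENDs carry a SMALLNESS of `γ` against the
history-feedback constant `C`.  THIS FILE shows that some such window is NECESSARY — neither END holds on the bare list
{`UniformShift ω → 0`, `HistLipschitz` + `FadingMemory`, runs in the box, the pin}, not even with BOTH asymptotic-freedom binders added.

THE WITNESS (kernel; an explicit caricature, NOT Bałaban's β).  `γ = 1`.  The TENT `tentF x = 1 + 2·max(0, 1 − |x − 4|)` in the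
recursion variable `x = 1∕g²` and the scale-free Markov family `tentBeta k (g_0,…,g_k) = tentF (1∕g_k²)`.  Then (0.20) reads
`x_k = x_{k+1} + tentF x_k`, i.e. `x_{k+1} = T x_k` with `T x = x − tentF x`, and `T` is NOT injective: `T 2 = T 4 = 1`.  Two runs
pinned at `x = 1` (`g_IR = 1 = γ`), by depth below the pin: run P `1, 2, 3, 14∕3, 17∕3, 20∕3, …` and run Q `1, 4, 5, 6, 7, …`
(`xP`, `xQ`; each solves (0.20): `xP_succ`, `xQ_succ`), all `x ≥ 1` (couplings `1∕√x ∈ ]0,1]`).  The family `tentRuns K` = run P for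
even `K`, run Q for odd `K`.  CHECKED: `tentRuns_rgEqH` ((0.20) for every `K`), `tentRuns_box`, `tentRuns_pin`;
`tentBeta_uniformShift` — `UniformShift (fun _ ↦ 0) 1 tentBeta` (the n-shift modulus is IDENTICALLY ZERO: a scale-free family forgets
the cutoff at once; a fortiori NE4 `ScaleShiftRate 0 θ 1` at every θ, `tentBeta_scaleShiftRate`); `tentBeta_lastOnly` —
`LastOnlyLipschitz 160 1` (the tent is 2-Lipschitz in `x`, `x = 1∕g²` is steep only where the tent is flat), hence `HistLipschitz` with
the DIAGONAL moduli and `FadingMemory 160 θ` for EVERY `θ ≥ 0` (`T4CouplingMatching.histLipschitz_of_lastOnly`, `fadingMemory_diag`);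
`tentBeta_lower` ∕ `tentBeta_upper` — `BetaLowerH 1 1` (discrete asymptotic freedom in its strongest, all-k form) and `BetaUpperH 3 1`.
AND YET `tentRuns_mismatch`: for every `K ≥ 1`, `|1∕(g^{(K)}_{K−1})² − 1∕(g^{(K+1)}_{K})²| = 2` — the runs `K` and `K + 1` differ at
depth 1 by a fixed amount (`discAt 1 (tentRuns K) (tentRuns (K+1)) (K−1) = 2`), so the conclusion of `direct_matching_eventually`
∕ `direct_matching_eventually_gap` FAILS (`tentRuns_not_matching`: no `K₀` works for `M = 1`, `ε = 1∕5`).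

WHAT THIS SAYS FOR THE ROW (R52)(ii).  With feedback constant `C = 160` and `γ = 1` both windows are violated and nothing else in either
hypothesis list is — so node U2's direct matching is NOT a consequence of {cutoff-forgetting, fading memory, asymptotic freedom, box,
pin} alone: a window «`γ` small against `C`» is load-bearing, the kind of restriction [Balaban1987RG1] Thm 3 p. 264 places on `γ`
(«The constant γ depends on all other constants»).  Mechanism: loss of BACKWARD UNIQUENESS of (0.20) when β varies by more than the
step absorbs (`T` non-injective needs a g-Lipschitz constant `> 2∕γ³`; the sufficient windows are `C·γ³ ≲ (1−θ)²∕4`): the γ³-scaling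
of the windows is the right one.  NE4 PROPER unchanged: NOT PRINTED, NOT PROVED, DEPENDENT; spine PROVED 0∕9 before and after.

HONEST FRAMING.  An explicit real-analysis counterexample on the cell's hypothesis SHAPES (0 sorry, standard axioms); the tent family is a
caricature chosen to violate the window, NOT a statement about Bałaban's β-functions (whose history feedback is expected to be small);
nothing of Bałaban's is asserted or instantiated; rung (B)+1 on ONE finite T⁴ — NOT ℝ⁴, NOT infinite volume, NOT a mass gap, NOT Clay.

References (TYPES only): [Balaban1987RG1] = T. Bałaban, Commun. Math. Phys. **109** (1987) 249–301, (0.20) p. 256, Thm 3 p. 264.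
-/

noncomputable section

namespace Summit.QuantumFields.BalabanUV.T4Continuum.Spine.NE4.KingCurrencyWindowWitness

open Finset Filter Topology
open Literature.MathematicalPhysics.QuantumFieldTheory.Balaban1983to89
open Literature.MathematicalPhysics.QuantumFieldTheory.Balaban1983to89.FlowStep
open Literature.MathematicalPhysics.QuantumFieldTheory.Balaban1983to89.T4CouplingMatching
open Summit.QuantumFields.BalabanUV.T4Continuum.Spine.NE4.KingCurrency

/-! ## §1 The tent β-function in the recursion variable and its scale-free Markov family -/

/-- The TENT in the recursion variable `x = 1∕g²`: `1 + 2·max(0, 1 − |x − 4|)` — equal to `1` off `]3,5[`, peak `3` at `x = 4`,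
slopes `±2`. [folklore] -/
def tentF (x : ℝ) : ℝ := 1 + 2 * max 0 (1 - |x - 4|)

/-- The scale-free Markov family `β_{k+1}(g_0,…,g_k) = tentF (1∕g_k²)` (a caricature, NOT Bałaban's β). [folklore] -/
def tentBeta : HBeta := fun k v => tentF (1 / (v (Fin.last k)) ^ 2)

/-- `1 ≤ tentF x ≤ 3`. [folklore] -/
theorem tentF_bounds (x : ℝ) : 1 ≤ tentF x ∧ tentF x ≤ 3 := by
  have h0 : 0 ≤ max 0 (1 - |x - 4|) := le_max_left _ _
  have h1 : max 0 (1 - |x - 4|) ≤ 1 := max_le zero_le_one (by linarith [abs_nonneg (x - 4)])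
  simp only [tentF]
  constructor <;> linarith

/-- Off the tent: `|x − 4| ≥ 1 ⇒ tentF x = 1`. [folklore] -/
theorem tentF_flat {x : ℝ} (hx : 1 ≤ |x - 4|) : tentF x = 1 := by
  simp only [tentF, max_eq_left (by linarith : 1 - |x - 4| ≤ 0)]
  ring

/-- The tent is 2-Lipschitz in `x`. [folklore] -/
theorem tentF_lip (x y : ℝ) : |tentF x - tentF y| ≤ 2 * |x - y| := by
  have h1 : |max 0 (1 - |x - 4|) - max 0 (1 - |y - 4|)| ≤ |x - y| := by
    have h := abs_max_sub_max_le_max (0 : ℝ) (1 - |x - 4|) 0 (1 - |y - 4|)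
    have h2 : |(1 - |x - 4|) - (1 - |y - 4|)| ≤ |x - y| := by
      have h3 := abs_abs_sub_abs_le_abs_sub (y - 4) (x - 4)
      rw [show (1 - |x - 4|) - (1 - |y - 4|) = |y - 4| - |x - 4| by ring]
      rw [show y - 4 - (x - 4) = y - x by ring, abs_sub_comm y x] at h3
      exact h3
    refine h.trans ?_
    rw [sub_self, abs_zero]
    exact max_le (abs_nonneg _) h2
  have e : tentF x - tentF y = 2 * (max 0 (1 - |x - 4|) - max 0 (1 - |y - 4|)) := by
    simp only [tentF]
    ring
  rw [e, abs_mul, abs_two]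
  linarith

/-- `|tentF x − tentF y| ≤ 2` always. [folklore] -/
theorem tentF_osc (x y : ℝ) : |tentF x - tentF y| ≤ 2 := by
  rw [abs_le]
  constructor <;> linarith [tentF_bounds x, tentF_bounds y]

/-- THE COUPLING-LIPSCHITZ BOUND: on `]0,1]`, `|tentF (1∕a²) − tentF (1∕b²)| ≤ 160·|a − b|` (both `≥ 2∕5`: `x = 1∕g²` is
`625∕8`-Lipschitz there and the tent 2-Lipschitz; one `< 2∕5`: that value is `1`, and either the other is `1` too or the two
couplings are `≥ 1∕25` apart). [folklore] -/
theorem tent_coupling_lip {a b : ℝ} (ha : 0 < a) (ha1 : a ≤ 1) (hb : 0 < b) (hb1 : b ≤ 1) :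
    |tentF (1 / a ^ 2) - tentF (1 / b ^ 2)| ≤ 160 * |a - b| := by
  -- a small coupling is off the tent: `g < 2∕5 ⇒ 1∕g² > 6 ⇒ tentF = 1`; more precisely `g² ≤ 1∕5` suffices
  have hflat : ∀ {g : ℝ}, 0 < g → g ^ 2 ≤ 1 / 5 → tentF (1 / g ^ 2) = 1 := by
    intro g hg hg2
    have hg2pos : 0 < g ^ 2 := by positivity
    have h5 : 5 ≤ 1 / g ^ 2 := by
      rw [le_div_iff₀ hg2pos]
      linarith
    exact tentF_flat ((by linarith : (1 : ℝ) ≤ 1 / g ^ 2 - 4).trans (le_abs_self _))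
  by_cases hA : 2 / 5 ≤ a <;> by_cases hB : 2 / 5 ≤ b
  · -- both on the steep-safe region
    have ha2 : 0 < a ^ 2 := by positivity
    have hb2 : 0 < b ^ 2 := by positivity
    have key : 1 / a ^ 2 - 1 / b ^ 2 = (b - a) * ((a + b) / (a ^ 2 * b ^ 2)) := by
      field_simp
      ring
    have hfac : (a + b) / (a ^ 2 * b ^ 2) ≤ 625 / 8 := by
      rw [div_le_iff₀ (by positivity)]
      have hab : 4 / 25 ≤ a * b := by nlinarith
      have hab2 : 16 / 625 ≤ a ^ 2 * b ^ 2 := by nlinarith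
      nlinarith
    have hfac0 : 0 ≤ (a + b) / (a ^ 2 * b ^ 2) := by positivity
    calc |tentF (1 / a ^ 2) - tentF (1 / b ^ 2)| ≤ 2 * |1 / a ^ 2 - 1 / b ^ 2| := tentF_lip _ _
      _ = 2 * (|a - b| * ((a + b) / (a ^ 2 * b ^ 2))) := by
          rw [key, abs_mul, abs_of_nonneg hfac0, abs_sub_comm]
      _ ≤ 2 * (|a - b| * (625 / 8)) :=
          mul_le_mul_of_nonneg_left (mul_le_mul_of_nonneg_left hfac (abs_nonneg _)) (by norm_num)
      _ ≤ 160 * |a - b| := by nlinarith [abs_nonneg (a - b)]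
  · -- `b < 2∕5 ≤ a`
    rw [not_le] at hB
    have hbflat := hflat hb (by nlinarith)
    by_cases ha5 : a ^ 2 ≤ 1 / 5
    · rw [hflat ha ha5, hbflat, sub_self, abs_zero]
      positivity
    · rw [not_le] at ha5
      have ha44 : 44 / 100 < a := by nlinarith
      have hgap : 1 / 25 ≤ |a - b| := by
        rw [abs_of_pos (by linarith)]
        linarith
      exact (tentF_osc _ _).trans (by linarith)
  · -- `a < 2∕5 ≤ b`
    rw [not_le] at hA
    have haflat := hflat ha (by nlinarith)
    by_cases hb5 : b ^ 2 ≤ 1 / 5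
    · rw [hflat hb hb5, haflat, sub_self, abs_zero]
      positivity
    · rw [not_le] at hb5
      have hb44 : 44 / 100 < b := by nlinarith
      have hgap : 1 / 25 ≤ |a - b| := by
        rw [abs_sub_comm, abs_of_pos (by linarith)]
        linarith
      exact (tentF_osc _ _).trans (by linarith)
  · -- both small: both values are `1`
    rw [not_le] at hA hB
    rw [hflat ha (by nlinarith), hflat hb (by nlinarith), sub_self, abs_zero]
    positivity

/-- `LastOnlyLipschitz 160 1 tentBeta` (Markov-type feedback with ONE constant). [folklore] -/
theorem tentBeta_lastOnly : LastOnlyLipschitz 160 1 tentBeta := by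
  intro k p q hp hq
  have hpk := (mem_box.mp hp) (Fin.last k)
  have hqk := (mem_box.mp hq) (Fin.last k)
  exact tent_coupling_lip hpk.1 hpk.2 hqk.1 hqk.2

/-- Hence `HistLipschitz` with the DIAGONAL moduli and `FadingMemory 160 θ` for EVERY `θ ≥ 0` — the memory companion of node U2 in
its strongest form. [folklore] -/
theorem tentBeta_histLipschitz_fading {θ : ℝ} (hθ : 0 ≤ θ) :
    HistLipschitz (fun k i => if i = k then (160 : ℝ) else 0) 1 tentBeta
      ∧ FadingMemory 160 θ (fun k i => if i = k then (160 : ℝ) else 0) :=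
  ⟨histLipschitz_of_lastOnly tentBeta_lastOnly, fadingMemory_diag (by norm_num) hθ⟩

/-- `UniformShift (fun _ ↦ 0) 1 tentBeta`: the n-shift modulus of a scale-free family is IDENTICALLY ZERO (the King-currency input
in its strongest form, `ω ≡ 0`). [folklore] -/
theorem tentBeta_uniformShift : UniformShift (fun _ => 0) 1 tentBeta := by
  intro n j g _
  simp [tentBeta, prefixOf_apply, Fin.val_last]

/-- A fortiori NE4 holds for the witness with constant ZERO: `ScaleShiftRate 0 θ 1 tentBeta` for every `θ`. [folklore] -/
theorem tentBeta_scaleShiftRate (θ : ℝ) : ScaleShiftRate 0 θ 1 tentBeta := by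
  intro k w _
  simp [tentBeta, Fin.tail, Fin.succ_last]

/-- Both asymptotic-freedom binders: `BetaLowerH 1 1 tentBeta` (all-k discrete asymptotic freedom, `β ≥ 1`). [folklore] -/
theorem tentBeta_lower : BetaLowerH 1 1 tentBeta := fun _ _ _ => (tentF_bounds _).1

/-- … and `BetaUpperH 3 1 tentBeta`. [folklore] -/
theorem tentBeta_upper : BetaUpperH 3 1 tentBeta := fun _ _ _ => (tentF_bounds _).2

/-- … hence `EventualLowerH 1 1 k₀ tentBeta` for every `k₀`. [folklore] -/
theorem tentBeta_eventualLower (k₀ : ℕ) : EventualLowerH 1 1 k₀ tentBeta :=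
  eventualLowerH_of_betaLowerH tentBeta_lower k₀

/-! ## §2 Two pinned runs, by depth below the pin, in the recursion variable -/

/-- Run P by depth: `1, 2, 3, 14∕3, 17∕3, 20∕3, …` (`d + 5∕3` from depth 3 on). [folklore] -/
def xP (d : ℕ) : ℝ := if d = 0 then 1 else if d = 1 then 2 else if d = 2 then 3 else (d : ℝ) + 5 / 3

/-- Run Q by depth: `1, 4, 5, 6, …` (`d + 3` from depth 1 on). [folklore] -/
def xQ (d : ℕ) : ℝ := if d = 0 then 1 else (d : ℝ) + 3

/-- Run P solves (0.20) backward from the pin: `xP (d+1) = xP d + tentF (xP (d+1))`. [folklore] -/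
theorem xP_succ (d : ℕ) : xP (d + 1) = xP d + tentF (xP (d + 1)) := by
  rcases Nat.lt_or_ge d 3 with hd | hd
  · interval_cases d
    · -- depth 1: `2 = 1 + tentF 2`, `tentF 2 = 1`
      have h : tentF 2 = 1 := tentF_flat (by norm_num [abs_of_nonpos])
      have e1 : xP 1 = 2 := by simp [xP]
      rw [e1, show xP 0 = 1 by simp [xP], h]
      norm_num
    · -- depth 2: `3 = 2 + tentF 3`, `tentF 3 = 1`
      have h : tentF 3 = 1 := tentF_flat (by norm_num [abs_of_nonpos])
      have e2 : xP 2 = 3 := by simp [xP]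
      have e1 : xP 1 = 2 := by simp [xP]
      rw [e2, e1, h]
      norm_num
    · -- depth 3: `14∕3 = 3 + tentF (14∕3)`, `tentF (14∕3) = 5∕3`
      have h : tentF (14 / 3) = 5 / 3 := by
        simp only [tentF]
        rw [show (14 / 3 : ℝ) - 4 = 2 / 3 by norm_num, abs_of_pos (by norm_num : (0 : ℝ) < 2 / 3),
          max_eq_right (by norm_num)]
        norm_num
      have e3 : xP 3 = 14 / 3 := by
        simp [xP]
        norm_num
      have e2 : xP 2 = 3 := by simp [xP]
      rw [e3, e2, h]
      norm_num
  · -- depth ≥ 4: off the tent, steps of 1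
    have h1 : xP (d + 1) = (d : ℝ) + 1 + 5 / 3 := by
      unfold xP
      rw [if_neg (by omega), if_neg (by omega), if_neg (by omega)]
      push_cast
      ring
    have h0 : xP d = (d : ℝ) + 5 / 3 := by
      unfold xP
      rw [if_neg (by omega), if_neg (by omega), if_neg (by omega)]
    have hd' : (3 : ℝ) ≤ d := by exact_mod_cast hd
    have hflat : tentF ((d : ℝ) + 1 + 5 / 3) = 1 :=
      tentF_flat ((by linarith : (1 : ℝ) ≤ (d : ℝ) + 1 + 5 / 3 - 4).trans (le_abs_self _))
    rw [h1, h0, hflat]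
    ring

/-- Run Q solves (0.20) backward from the pin: `xQ (d+1) = xQ d + tentF (xQ (d+1))`. [folklore] -/
theorem xQ_succ (d : ℕ) : xQ (d + 1) = xQ d + tentF (xQ (d + 1)) := by
  rcases Nat.eq_zero_or_pos d with hd | hd
  · -- depth 1: `4 = 1 + tentF 4`, `tentF 4 = 3`
    subst hd
    have h : tentF 4 = 3 := by
      simp only [tentF, sub_self, abs_zero, sub_zero, max_eq_right (zero_le_one' ℝ)]
      norm_num
    have e1 : xQ 1 = 4 := by
      simp [xQ]
      norm_num
    rw [e1, show xQ 0 = 1 by simp [xQ], h]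
    norm_num
  · have h1 : xQ (d + 1) = (d : ℝ) + 1 + 3 := by
      unfold xQ
      rw [if_neg (by omega)]
      push_cast
      ring
    have h0 : xQ d = (d : ℝ) + 3 := by
      unfold xQ
      rw [if_neg (by omega)]
    have hd' : (1 : ℝ) ≤ d := by exact_mod_cast hd
    have hflat : tentF ((d : ℝ) + 1 + 3) = 1 :=
      tentF_flat ((by linarith : (1 : ℝ) ≤ (d : ℝ) + 1 + 3 - 4).trans (le_abs_self _))
    rw [h1, h0, hflat]
    ring

/-- `1 ≤ xP d`. [folklore] -/
theorem one_le_xP (d : ℕ) : 1 ≤ xP d := by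
  have hd : (0 : ℝ) ≤ d := Nat.cast_nonneg d
  unfold xP
  split_ifs <;> linarith

/-- `1 ≤ xQ d`. [folklore] -/
theorem one_le_xQ (d : ℕ) : 1 ≤ xQ d := by
  have hd : (0 : ℝ) ≤ d := Nat.cast_nonneg d
  unfold xQ
  split_ifs <;> linarith

/-! ## §3 The family of pinned runs: P at even cutoffs, Q at odd cutoffs -/

/-- The recursion variable of the family: run P for even `K`, run Q for odd `K`, read at scale `i` (depth `K − i`). [folklore] -/
def xRuns (K i : ℕ) : ℝ := if Even K then xP (K - i) else xQ (K - i)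

/-- `1 ≤ xRuns K i`. [folklore] -/
theorem one_le_xRuns (K i : ℕ) : 1 ≤ xRuns K i := by
  unfold xRuns
  split_ifs
  · exact one_le_xP _
  · exact one_le_xQ _

/-- THE WITNESS FAMILY OF RUNS: `g^{(K)}_i = 1∕√(xRuns K i)`. [folklore] -/
def tentRuns (K i : ℕ) : ℝ := 1 / Real.sqrt (xRuns K i)

/-- `1∕(g^{(K)}_i)² = xRuns K i`. [folklore] -/
theorem inv_sq_tentRuns (K i : ℕ) : 1 / (tentRuns K i) ^ 2 = xRuns K i := by
  have hx : 0 ≤ xRuns K i := zero_le_one.trans (one_le_xRuns K i)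
  rw [tentRuns, one_div_pow, Real.sq_sqrt hx, one_div_one_div]

/-- The runs lie in the box `]0,1]`. [folklore] -/
theorem tentRuns_box (K i : ℕ) (_hi : i ≤ K) : 0 < tentRuns K i ∧ tentRuns K i ≤ 1 := by
  have hx := one_le_xRuns K i
  have hs : 1 ≤ Real.sqrt (xRuns K i) := by
    rw [show (1 : ℝ) = Real.sqrt 1 by simp]
    exact Real.sqrt_le_sqrt hx
  refine ⟨by unfold tentRuns; positivity, ?_⟩
  unfold tentRuns
  rw [div_le_one (by linarith)]
  exact hs

/-- The runs are pinned at `g_IR = 1` (`= γ`). [folklore] -/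
theorem tentRuns_pin (K : ℕ) : tentRuns K K = 1 := by
  simp [tentRuns, xRuns, xP, xQ]

/-- The step identity of the family in the recursion variable: for `k < K`, `xRuns K k = xRuns K (k+1) + tentF (xRuns K k)`. [folklore] -/
theorem xRuns_step {K k : ℕ} (hk : k < K) : xRuns K k = xRuns K (k + 1) + tentF (xRuns K k) := by
  obtain ⟨d, hd⟩ : ∃ d, K - (k + 1) = d := ⟨_, rfl⟩
  have hKk : K - k = d + 1 := by omega
  unfold xRuns
  split_ifs
  · rw [hKk, hd]; exact xP_succ d
  · rw [hKk, hd]; exact xQ_succ d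

/-- EVERY run of the family solves (0.20) with the tent family: `RGEqH K tentBeta (tentRuns K)`. [folklore] -/
theorem tentRuns_rgEqH (K : ℕ) : RGEqH K tentBeta (tentRuns K) := by
  intro k hk
  have hβ : tentBeta k (prefixOf (tentRuns K) k) = tentF (xRuns K k) := by
    simp only [tentBeta, prefixOf_apply, Fin.val_last, inv_sq_tentRuns]
  rw [hβ, inv_sq_tentRuns, inv_sq_tentRuns]
  exact xRuns_step hk

/-! ## §4 The mismatch at depth 1, for every cutoff -/

/-- Depth 1 of run `K ≥ 1` and of run `K + 1`: the recursion variable is `2` resp. `4` or `4` resp. `2`. [folklore] -/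
theorem xRuns_depth_one {K : ℕ} (hK : 1 ≤ K) :
    (xRuns K (K - 1) = 2 ∧ xRuns (K + 1) K = 4) ∨ (xRuns K (K - 1) = 4 ∧ xRuns (K + 1) K = 2) := by
  have h1 : K - (K - 1) = 1 := by omega
  have h2 : K + 1 - K = 1 := by omega
  rcases Nat.even_or_odd K with hE | hO
  · left
    have hE' : ¬ Even (K + 1) := Nat.not_even_iff_odd.mpr (Even.add_one hE)
    simp [xRuns, hE, hE', h1, h2, xP, xQ]
    norm_num
  · right
    have hO' : ¬ Even K := Nat.not_even_iff_odd.mpr hO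
    have hE' : Even (K + 1) := Odd.add_one hO
    simp [xRuns, hO', hE', h1, h2, xP, xQ]
    norm_num

/-- **THE MISMATCH.**  For every cutoff `K ≥ 1` the runs `K` and `K + 1` differ at depth 1 by a fixed amount in the recursion variable:
`discAt 1 (tentRuns K) (tentRuns (K+1)) (K − 1) = 2`. [folklore] -/
theorem tentRuns_mismatch {K : ℕ} (hK : 1 ≤ K) : discAt 1 (tentRuns K) (tentRuns (K + 1)) (K - 1) = 2 := by
  rw [discAt, show K - 1 + 1 = K by omega, inv_sq_tentRuns, inv_sq_tentRuns]
  rcases xRuns_depth_one hK with ⟨h1, h2⟩ | ⟨h1, h2⟩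
  · rw [h1, h2]; norm_num
  · rw [h1, h2]; norm_num

/-- … and in the couplings, STRICTLY above `1∕5`: `|g^{(K+1)}_K − g^{(K)}_{K−1}| = 1∕√2 − 1∕2 > 1∕5`. [folklore] -/
theorem tentRuns_coupling_mismatch {K : ℕ} (hK : 1 ≤ K) : 1 / 5 < |tentRuns (K + 1) K - tentRuns K (K - 1)| := by
  have hs4 : Real.sqrt 4 = 2 := by
    rw [show (4 : ℝ) = 2 ^ 2 by norm_num, Real.sqrt_sq (by norm_num)]
  have hs2 : Real.sqrt 2 < 10 / 7 := by
    rw [show (10 / 7 : ℝ) = Real.sqrt ((10 / 7) ^ 2) by rw [Real.sqrt_sq (by norm_num)]]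
    exact Real.sqrt_lt_sqrt (by norm_num) (by norm_num)
  have hs2pos : 0 < Real.sqrt 2 := Real.sqrt_pos.mpr (by norm_num)
  have hkey : 1 / 5 < 1 / Real.sqrt 2 - 1 / Real.sqrt 4 := by
    rw [hs4]
    have h : 7 / 10 < 1 / Real.sqrt 2 := by
      rw [lt_div_iff₀ hs2pos]
      nlinarith
    linarith
  rcases xRuns_depth_one hK with ⟨h1, h2⟩ | ⟨h1, h2⟩
  · rw [tentRuns, tentRuns, h1, h2, abs_sub_comm]
    exact hkey.trans_le (le_abs_self _)
  · rw [tentRuns, tentRuns, h1, h2]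
    exact hkey.trans_le (le_abs_self _)

/-- **NODE U2's DIRECT MATCHING NEEDS A WINDOW.**  For the tent family and its pinned runs — which satisfy (0.20) for every cutoff, lie
in the box `]0,1]`, are pinned at `g_IR = 1`, have n-shift modulus ZERO, diagonal history moduli with `FadingMemory 160 θ` for every
`θ ≥ 0`, and both asymptotic-freedom binders `BetaLowerH 1 1` ∕ `BetaUpperH 3 1` — the conclusion of
`KingCurrencyWindow.direct_matching_eventually` ∕ `KingCurrencyGapEnd.direct_matching_eventually_gap` FAILS: there is NO `K₀` such that
for all `K ≥ K₀`, all `n` and `K − 1 ≤ j ≤ K`, `|g^{(K+n)}_{j+n} − g^{(K)}_j| ≤ 1∕5` (take `K = K₀ + 1`, `n = 1`, `j = K₀`).  Only the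
windows (`C((k₀+1)γ³ + 2γ∕b) ≤ (1−θ)∕2`, resp. `C·(γ³∕2)·τ∕(τ−θ) ≤ (1−τ)∕2`) are violated (`C = 160`, `γ = 1`): a smallness of `γ`
against the feedback constant is NECESSARY. [folklore] -/
theorem tentRuns_not_matching :
    ¬ ∃ K₀ : ℕ, ∀ K n j : ℕ, K₀ ≤ K → K ≤ j + 1 → j ≤ K →
      |tentRuns (K + n) (j + n) - tentRuns K j| ≤ 1 / 5 := by
  rintro ⟨K₀, h⟩
  have h1 := h (K₀ + 1) 1 K₀ (by omega) (by omega) (by omega)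
  have hgap := tentRuns_coupling_mismatch (K := K₀ + 1) (by omega)
  rw [show K₀ + 1 - 1 = K₀ by omega] at hgap
  exact absurd h1 (not_le.mpr hgap)

end Summit.QuantumFields.BalabanUV.T4Continuum.Spine.NE4.KingCurrencyWindowWitness
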